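import Summits.Langlands.Langlands.Theses.QuarterDeficit1951

/-!
# `CensusDeficit1951` (stmt-Langlands-17933) — CALIBRATION of the refutation debt

Line `Sketch`, lead c2 (2026-08-17), crux `Summit.Langlands.Langlands.Theses.QuarterDeficit1951.CensusDeficit1951` (D):
for every order-5 Dirichlet character `χ mod 1951` a CERTIFIED Maass–Hecke trace census transcript with the deficit
verdict. D is numerically FALSE (the fingerprinted odd `r = 0` newform is sighted in all four order-5 spaces,
`Cruxes/QuarterFingerprintDeficit/SightingHejhalR0.md`), and the kernel side of its refutation is complete MODULO a
construction hypothesis (`…Negative.CensusDeficit1951_false_of_OddWindowCertificate`, p161038, and two variants).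

This file proves the converse calibration, kernel-checked: **if, for every order-5 `χ`, every weight-0 Maass cusp
form on `(Γ₀(1951), χ)` (in the census' sense `IsMaassCuspFormOn 1951 χ u λ`) vanishes identically, then D holds**
(`CensusDeficit1951_of_forall_cuspForm_eq_zero`). Equivalently (`exists_cuspForm_ne_zero_of_not_CensusDeficit1951`):
ANY kernel proof of `¬ D` contains a construction of a nonzero Maass cusp form of prime level `1951` with an order-5
nebentypus — an object with no known construction in Lean/Mathlib (no dihedral/CM forms exist at the prime level
`1951 ≡ 3 (mod 4)`; automorphy of the Doud–Moore icosahedral form is an open case of Artin's conjecture; there is no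
spectral theory of `L²(Γ₀(N)\ℍ, χ)` in Mathlib). Together with the landed negative lemmas this pins D as independent
of everything constructible in-kernel today: `(no cusp forms) ⊢ D` and `(one fingerprinted window cusp form) ⊢ ¬D`.

Mechanism: the `J = ∅` model of the census semantics. With no cusp forms, the EMPTY family is complete joint spectral
data (`IsJointSpectralData`), and the explicit toy transcript in the proof below (BLS test function `h = sinc⁴(r/2)`, i.e.
`δ = 1`, `M = 1`, `x₀ = 1`; window `1/100`; `fpPrimes = []`; the zero box for `m₁(h)`; `hlo = 1/2`, `hhi = 2`)
encloses it: the empty sums are `0`, and the one genuinely analytic clause of `EnclosesSpectralData` — the certified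
window bounds `hlo ≤ h(r_λ) ≤ hhi` for `|λ − 1/4| ≤ 1/100` — is PROVED here from `x − x³/6 < sin x` and
`|eˣ − 1 − x| ≤ x²` (`toyTestFn_eval_bounds`; real branch `sinc⁴`, imaginary branch `(sinh s / s)⁴`, `s ≤ 1/20`).
Its verdict `certifiesDeficit` (`U = ⌊m1hi/hlo⌋ = 0`) is evaluated by `decide +kernel`. No order-5 hypothesis is used
(the per-character statement `exists_certifiedDeficitCensus_of_forall_cuspForm_eq_zero` holds for every `χ mod 1951`).
-/

-- `Summit.<Summit>.<Problem>`: for the single-conjunct summit `Langlands` the duplicate is mandated.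
set_option linter.dupNamespace false

namespace Summit.Langlands.Langlands.Theorems.CensusDeficit1951

open Literature.NumberTheory.Automorphic
open Summit.Langlands.Langlands.Theses.QuarterDeficit1951
open scoped UpperHalfPlane

/-! ## 1. Two elementary inequalities -/

/-- `sinc x ≥ 9/10` for `0 ≤ x ≤ 1/2` (from `x − x³/6 < sin x`). [folklore] -/
theorem nine_tenths_le_sinc {x : ℝ} (h0 : 0 ≤ x) (h1 : x ≤ 1 / 2) : 9 / 10 ≤ Real.sinc x := by
  rcases h0.eq_or_lt with rfl | hx
  · rw [Real.sinc_zero]; norm_num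
  · rw [Real.sinc_of_ne_zero hx.ne', le_div_iff₀ hx]
    have h := Real.sin_gt_sub_cube hx
    have hx2 : x ^ 2 ≤ 1 / 4 := by nlinarith
    have hx3 : x ^ 3 ≤ x / 4 := by
      calc x ^ 3 = x * x ^ 2 := by ring
        _ ≤ x * (1 / 4) := mul_le_mul_of_nonneg_left hx2 h0
        _ = x / 4 := by ring
    linarith

/-- `sinh s ≤ s + s²` for `0 ≤ s ≤ 1` (from `|eˣ − 1 − x| ≤ x²` at `x = ± s`). [folklore] -/
theorem sinh_le_self_add_sq {s : ℝ} (h0 : 0 ≤ s) (h1 : s ≤ 1) : Real.sinh s ≤ s + s ^ 2 := by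
  rw [Real.sinh_eq]
  have h₁ := Real.abs_exp_sub_one_sub_id_le (x := s) (by rwa [abs_of_nonneg h0])
  have h₂ := Real.abs_exp_sub_one_sub_id_le (x := -s) (by rwa [abs_neg, abs_of_nonneg h0])
  rw [neg_sq] at h₂
  have h₁' := (abs_le.mp h₁).2
  have h₂' := (abs_le.mp h₂).1
  linarith

/-! ## 2. The toy transcript and its certified window bounds -/

/-- **Certified window bounds for the toy test function**: `1/2 ≤ h(r_λ) ≤ 2` whenever `|λ − 1/4| ≤ 1/100`
(real branch: `h = sinc⁴(√(λ−1/4)/2)` with argument `≤ 1/20`; imaginary branch: `h = (sinh s/s)⁴`,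
`s = √(1/4−λ)/2 ∈ (0, 1/20]`). This is the clause `EnclosesSpectralData.window_bounds` for the toy transcript, proved in-kernel.
[folklore] -/
theorem toyTestFn_eval_bounds (lam : ℝ) (hw : |lam - 1 / 4| ≤ 1 / 100) :
    (1 / 2 : ℝ) ≤ (⟨1, [1]⟩ : SqTestFn).eval lam ∧ (⟨1, [1]⟩ : SqTestFn).eval lam ≤ 2 := by
  obtain ⟨hw1, hw2⟩ := abs_le.mp hw
  have hsq : Real.sqrt (1 / 100) = 1 / 10 := by
    rw [show (1 / 100 : ℝ) = (1 / 10) ^ 2 by norm_num, Real.sqrt_sq (by norm_num)]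
  unfold SqTestFn.eval
  simp only [List.length_singleton, Finset.sum_range_one, List.getD_cons_zero, Rat.cast_one, one_mul,
    Nat.cast_zero, zero_mul, Real.cos_zero, Real.cosh_zero, mul_one]
  split_ifs with hlam
  · -- real branch: `a := sinc (√(λ - 1/4) / 2) ∈ [9/10, 1]`
    set x := Real.sqrt (lam - 1 / 4) / 2 with hx
    have hx0 : 0 ≤ x := by positivity
    have hx1 : x ≤ 1 / 2 := by
      have : Real.sqrt (lam - 1 / 4) ≤ 1 / 10 := by
        rw [← hsq]; exact Real.sqrt_le_sqrt (by linarith)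
      rw [hx]; linarith
    have ha0 : 9 / 10 ≤ Real.sinc x := nine_tenths_le_sinc hx0 hx1
    have ha1 : Real.sinc x ≤ 1 := Real.sinc_le_one x
    have h2lo : 81 / 100 ≤ Real.sinc x ^ 2 := by nlinarith
    have h2hi : Real.sinc x ^ 2 ≤ 1 := by nlinarith
    constructor <;> nlinarith
  · -- imaginary branch: `ρ := sinh s / s ∈ [1, 21/20]`, `s = √(1/4 - λ)/2 ∈ (0, 1/20]`
    push Not at hlam
    set s := Real.sqrt (1 / 4 - lam) / 2 with hs
    have hs0 : 0 < s := by
      have : 0 < Real.sqrt (1 / 4 - lam) := Real.sqrt_pos.mpr (by linarith)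
      rw [hs]; linarith
    have hs1 : s ≤ 1 / 20 := by
      have : Real.sqrt (1 / 4 - lam) ≤ 1 / 10 := by
        rw [← hsq]; exact Real.sqrt_le_sqrt (by linarith)
      rw [hs]; linarith
    have hlo : 1 ≤ Real.sinh s / s := by
      rw [le_div_iff₀ hs0, one_mul]; exact Real.self_le_sinh_iff.mpr hs0.le
    have hhi : Real.sinh s / s ≤ 21 / 20 := by
      rw [div_le_iff₀ hs0]
      have := sinh_le_self_add_sq hs0.le (by linarith)
      nlinarith
    have h2lo : 1 ≤ (Real.sinh s / s) ^ 2 := by nlinarith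
    have h2hi : (Real.sinh s / s) ^ 2 ≤ 441 / 400 := by nlinarith
    constructor <;> nlinarith

/-! ## 3. The calibration theorems -/

/-- **Per-character calibration.** If every Maass cusp form on `(Γ₀(1951), χ)` vanishes identically, the toy
transcript is a certified census of `(Γ₀(1951), χ)` with the deficit verdict (and window `1/100`, tolerance
`1/100`, fingerprint primes `∅ ⊆ {2,…,13}`): the empty family is complete joint spectral data, empty sums are `0`,
and the window bounds are `toyTestFn_eval_bounds`. [folklore] -/
theorem exists_certifiedDeficitCensus_of_forall_cuspForm_eq_zero (χ : DirichletCharacter ℂ 1951)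
    (h0 : ∀ (u : ℍ → ℂ) (lam : ℝ), IsMaassCuspFormOn 1951 χ u lam → u = 0) :
    ∃ c : MaassHeckeTraceCensus, (1 / 100 : ℚ) ≤ c.window ∧ (1 / 100 : ℚ) ≤ c.fpTol ∧
      (∀ p ∈ c.fpPrimes, p ∈ ({2, 3, 5, 7, 11, 13} : Finset ℕ)) ∧
      CertifiedMaassHeckeTraceCensus 1951 χ c ∧ c.certifiesDeficit = true := by
  -- the toy transcript: level 1951, window 1/100, fpPrimes = [], fpTol 1/100, h = ⟨1, [1]⟩ (sinc⁴(r/2)),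
  -- hlo = 1/2, hhi = 2, the zero box for m₁(h), no Hecke bounds, no χ-boxes, no tail slot
  refine ⟨MaassHeckeTraceCensus.mk 1951 (1 / 100) [] (1 / 100) (SqTestFn.mk 1 [1]) (1 / 2) 2
      [(1, QCBox.zero)] [] [] none,
    le_rfl, le_rfl, fun p hp => ?_, ⟨rfl, ?_, PEmpty, PEmpty.elim, ?_, ?_⟩, ?_⟩
  · exact absurd hp (by simp)
  · -- `wellFormed` (kernel evaluation of the decidable bookkeeping)
    decide +kernel
  · -- the empty family is complete joint spectral data when there are no cusp forms
    exact
      { lam_pos := fun j => j.elim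
        hecke_one := fun j => j.elim
        norm_hecke_le := fun j => j.elim
        exists_eigenbasis := ⟨PEmpty.elim, fun j => j.elim, fun j => j.elim, linearIndependent_empty_type,
          fun v lam hv => by rw [h0 v lam hv]; exact Submodule.zero_mem _⟩ }
  · -- the toy boxes enclose the (empty) data: empty sums are `0`, every recorded box is the zero box,
    -- the window bounds are `toyTestFn_eval_bounds`, and there are no `χ`-boxes and no tail slot
    refine ⟨fun n _ => ⟨0, hasSum_empty, ?_⟩, fun lam _ hlam => ?_, fun p hp => ?_, fun g B h => ?_⟩
    · unfold MaassHeckeTraceCensus.trace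
      simp only [List.lookup]
      split <;> simp [QCBox.mem, QIvl.mem, QCBox.zero]
    · have hb := toyTestFn_eval_bounds lam (by simpa [MaassHeckeTraceCensus.inWindow] using hlam)
      show ((1 / 2 : ℚ) : ℝ) ≤ SqTestFn.eval ⟨1, [1]⟩ lam ∧ SqTestFn.eval ⟨1, [1]⟩ lam ≤ ((2 : ℚ) : ℝ)
      push_cast
      exact hb
    · exact absurd hp (by simp)
    · exact absurd h (by simp)
  · -- `certifiesDeficit` (kernel evaluation: well-formed and `U = ⌊0 / (1/2)⌋ = 0`)
    decide +kernel

/-- **Registered stub `stub_calibration` of line `Sketch`** (skeleton `Cruxes/CensusDeficit1951/Lines/Sketch.lean`,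
lead c2): the per-character calibration, by name and signature. [folklore] -/
theorem stub_calibration :
    ∀ χ : DirichletCharacter ℂ 1951,
      (∀ (u : UpperHalfPlane → ℂ) (lam : ℝ), IsMaassCuspFormOn 1951 χ u lam → u = 0) →
      ∃ c : MaassHeckeTraceCensus, (1 / 100 : ℚ) ≤ c.window ∧ (1 / 100 : ℚ) ≤ c.fpTol ∧
        (∀ p ∈ c.fpPrimes, p ∈ ({2, 3, 5, 7, 11, 13} : Finset ℕ)) ∧
        CertifiedMaassHeckeTraceCensus 1951 χ c ∧ c.certifiesDeficit = true :=
  exists_certifiedDeficitCensus_of_forall_cuspForm_eq_zero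

/-- **Calibration of the crux `CensusDeficit1951`.** If, for every order-5 character `χ mod 1951`, every Maass
cusp form on `(Γ₀(1951), χ)` vanishes identically, then the crux holds (by name). The hypothesis is false in
reality (Weyl's law; the sighted `r = 0` newforms) but irrefutable in-kernel today; the theorem calibrates the
refutation debt, see `exists_cuspForm_ne_zero_of_not_CensusDeficit1951`. [folklore] -/
theorem CensusDeficit1951_of_forall_cuspForm_eq_zero
    (h0 : ∀ χ : DirichletCharacter ℂ 1951, orderOf χ = 5 →
      ∀ (u : ℍ → ℂ) (lam : ℝ), IsMaassCuspFormOn 1951 χ u lam → u = 0) :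
    CensusDeficit1951 :=
  fun χ hχ => exists_certifiedDeficitCensus_of_forall_cuspForm_eq_zero χ (h0 χ hχ)

/-- **The refutation debt of `CensusDeficit1951`, kernel-certified**: any proof of `¬ CensusDeficit1951` yields an
order-5 character `χ mod 1951` and a NONZERO weight-0 Maass cusp form on `(Γ₀(1951), χ)` (some eigenvalue `λ`).
[folklore] -/
theorem exists_cuspForm_ne_zero_of_not_CensusDeficit1951 (h : ¬ CensusDeficit1951) :
    ∃ χ : DirichletCharacter ℂ 1951, orderOf χ = 5 ∧
      ∃ (u : ℍ → ℂ) (lam : ℝ), IsMaassCuspFormOn 1951 χ u lam ∧ u ≠ 0 := by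
  by_contra hne
  push Not at hne
  exact h (CensusDeficit1951_of_forall_cuspForm_eq_zero fun χ hχ u lam hu => hne χ hχ u lam hu)

end Summit.Langlands.Langlands.Theorems.CensusDeficit1951
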